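import Mathlib
import Summits.ValiantsHypothesis.ValiantsHypothesis.Theorems.BarrierLeverPartitionMinorsHitByVPHiddenStatesTiltTable

/-!
# Route BarrierLever — item `PartitionMinorsHitByVP` (stmt-ValiantsHypothesis-19717), line `hidden-states`:
# TILTED CUBES III — the structured columns of the TILT TABLE are linearly independent (canonical coordinates)

Helper file (`--supports stmt-ValiantsHypothesis-19717`; cell valiant-natproofs, rung V4, 𝒟-side door (c), registered line
`Cruxes/PartitionMinorsHitByVP/Lines/hidden_states.lean` v7; prover seat val-np-p6 gen 12). Definition-free; closes NO item.

THE POINT (memo val-np-p6 g11 §5 asked for the «first beyond-cuts mechanism»; it is one line of arithmetic). With the tilt table of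
`…TiltTable` (piece `p₀`: 0/1 cube on the coordinates `≠ x₀` whose state `d` also carries `x₀`; piece `p₁`: hidden points
`(1_B; |B|; 1+|B|)`, off the hyperplane `x₀ = y₀`), against ANY row family containing all sets of size `≤ d` and `univ ∖ x₀`, the
columns of `p₀, p₁` are LINEARLY INDEPENDENT (`exists_indepTable`): comparing the rows `T ∪ x₀`, `T ∪ y₀`, `T ∪ x₀ ∪ y₀` kills the
`p₀`-part and leaves for the `p₁`-coefficients the superset sums `Σ_{B ⊇ T} a₁(B) = 0` (`T ≠ univ`) and `Σ_{B ⊇ T} a₁(B)|B|² = 0`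
(`|T| ≤ d−2`); the first forces `a₁ = λ·parity` (`Tilt.eq_parity_of_sum_supersets`), the second at a co-doubleton gives `2λ = 0`
(`Tilt.parity_quadratic_moment`); then the `p₀`-coefficients die by Möbius inversion. With free completion (p626424) this is the flag
design `𝔉(h,2)` serving `B_{h−2}([h]) ∪ {univ ∖ x₀}` — the core-ONE family no cut tree certifies (sequel `…TiltCells`).

WHAT THIS IS NOT: one configuration (two tilted cubes, core exactly one); nothing on crux 14610 or VP ≠ VNP.
-/

set_option linter.dupNamespace false

namespace Summit.ValiantsHypothesis.ValiantsHypothesis.Theorems.BarrierLever.HiddenStates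

open Finset

noncomputable section

namespace Tilt

/-- **THE TILT TABLE HAS INDEPENDENT STRUCTURED COLUMNS.** See the module docstring. `d ≥ 2`; states `Fin K` with `d + 1 ≤ K`;
piece `p₀` uses only states `< d + 1`, piece `p₁ ≠ p₀` only states `< d`; the rows contain every set of size `≤ d` and
`univ ∖ {x₀}`, `x₀ = Fin.last (d+1)`. Conclusion: for an explicit table `tx₀`, every vanishing combination of columns supported
on the pieces `p₀, p₁` is trivial. -/
theorem exists_indepTable (d r m K : ℕ) (hd : 2 ≤ d) (hK : d + 1 ≤ K) (e : Fin r → Fin m × Finset (Fin K))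
    (he : Function.Injective e) (p₀ p₁ : Fin m) (hp : p₀ ≠ p₁)
    (hP0 : ∀ k, (e k).1 = p₀ → ∀ q ∈ (e k).2, (q : ℕ) < d + 1)
    (hP1 : ∀ k, (e k).1 = p₁ → ∀ q ∈ (e k).2, (q : ℕ) < d)
    (u : Fin r → Finset (Fin (d + 2)))
    (hrows : ∀ S : Finset (Fin (d + 2)), S.card ≤ d → S ∈ Set.range u)
    (hrow' : Finset.univ.erase (Fin.last (d + 1)) ∈ Set.range u) :
    ∃ tx₀ : Fin m → Option (Fin K) → Fin (d + 2) → ℂ,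
      ∀ α : Fin r → ℂ, (∀ k, (e k).1 ≠ p₀ → (e k).1 ≠ p₁ → α k = 0) →
        (∑ k, α k • (fun i => ∏ a ∈ u i, (tx₀ (e k).1 none a + ∑ q ∈ (e k).2, tx₀ (e k).1 (some q) a))) = 0 →
        ∀ k, α k = 0 := by
  classical
  -- coordinates
  let cc : Fin d ↪ Fin (d + 2) := Fin.castAddEmb 2
  let y₀ : Fin (d + 2) := ⟨d, by omega⟩
  let x₀ : Fin (d + 2) := ⟨d + 1, by omega⟩
  have hx₀ : x₀ = Fin.last (d + 1) := rfl
  have hccv : ∀ i : Fin d, ((cc i : Fin (d + 2)) : ℕ) = i := fun i => rfl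
  -- states
  let st : Fin d → Fin K := fun i => ⟨i, by omega⟩
  let sd : Fin K := ⟨d, by omega⟩
  -- the tilt table (`…TiltTable`) and its hidden points
  obtain ⟨tx₀, hT0, hT1⟩ := exists_tiltTable d m K hK p₀ p₁ hp
  refine ⟨tx₀, ?_⟩
  intro α hα hsum
  let pt : Fin r → Fin (d + 2) → ℂ := fun k a => tx₀ (e k).1 none a + ∑ q ∈ (e k).2, tx₀ (e k).1 (some q) a
  let low : Fin r → Finset (Fin d) := fun k => Finset.univ.filter fun i => st i ∈ (e k).2
  set C0 : Finset (Fin r) := Finset.univ.filter fun k => (e k).1 = p₀ with hC0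
  set C1 : Finset (Fin r) := Finset.univ.filter fun k => (e k).1 = p₁ with hC1
  have hC0mem : ∀ k ∈ C0, (e k).1 = p₀ := fun k hk => (Finset.mem_filter.mp hk).2
  have hC1mem : ∀ k ∈ C1, (e k).1 = p₁ := fun k hk => (Finset.mem_filter.mp hk).2
  have hpt0c : ∀ k ∈ C0, ∀ i : Fin d, pt k (cc i) = if st i ∈ (e k).2 then 1 else 0 := fun k hk i => by
    simp only [pt, hC0mem k hk]; exact (hT0 (e k).2 (hP0 k (hC0mem k hk))).1 i
  have hpt0y : ∀ k ∈ C0, pt k y₀ = if sd ∈ (e k).2 then 1 else 0 := fun k hk => by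
    simp only [pt, hC0mem k hk]; exact (hT0 (e k).2 (hP0 k (hC0mem k hk))).2.1
  have hpt0x : ∀ k ∈ C0, pt k x₀ = if sd ∈ (e k).2 then 1 else 0 := fun k hk => by
    simp only [pt, hC0mem k hk]; exact (hT0 (e k).2 (hP0 k (hC0mem k hk))).2.2
  have hpt1c : ∀ k ∈ C1, ∀ i : Fin d, pt k (cc i) = if st i ∈ (e k).2 then 1 else 0 := fun k hk i => by
    simp only [pt, hC1mem k hk]; exact (hT1 (e k).2 (hP1 k (hC1mem k hk))).1 i
  have hpt1y : ∀ k ∈ C1, pt k y₀ = ((e k).2.card : ℂ) := fun k hk => by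
    simp only [pt, hC1mem k hk]; exact (hT1 (e k).2 (hP1 k (hC1mem k hk))).2.1
  have hpt1x : ∀ k ∈ C1, pt k x₀ = ((e k).2.card : ℂ) + 1 := fun k hk => by
    simp only [pt, hC1mem k hk]; exact (hT1 (e k).2 (hP1 k (hC1mem k hk))).2.2
  -- for `p₁`-columns the state set is the image of `low`
  have hcard1 : ∀ k ∈ C1, ((e k).2).card = (low k).card := by
    intro k hk
    have hk' : (e k).1 = p₁ := (Finset.mem_filter.mp hk).2
    have himg : (low k).image st = (e k).2 := by
      ext q
      simp only [Finset.mem_image, low, Finset.mem_filter, Finset.mem_univ, true_and]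
      constructor
      · rintro ⟨i, hi, rfl⟩; exact hi
      · intro hq
        have := hP1 k hk' q hq
        refine ⟨⟨q, this⟩, ?_, Fin.ext rfl⟩
        have : st ⟨q, this⟩ = q := Fin.ext rfl
        rw [this]; exact hq
    rw [← himg, Finset.card_image_of_injective]
    intro i j hij; exact Fin.ext (by simpa [st] using congrArg Fin.val hij)
  -- the four row shapes and their entries
  have hprodc : ∀ k, (∀ i : Fin d, pt k (cc i) = if st i ∈ (e k).2 then 1 else 0) →
      ∀ T : Finset (Fin d), ∏ a ∈ T.map cc, pt k a = if T ⊆ low k then 1 else 0 := by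
    intro k hk T
    rw [Finset.prod_map]
    simp_rw [hk]
    rw [Finset.prod_boole]
    have : (∀ i ∈ T, st i ∈ (e k).2) ↔ T ⊆ low k := by
      simp only [low, Finset.subset_iff, Finset.mem_filter, Finset.mem_univ, true_and]
    simp only [this]
  have hy_notmem : ∀ T : Finset (Fin d), y₀ ∉ T.map cc := by
    intro T h'
    obtain ⟨i, -, hi⟩ := Finset.mem_map.mp h'
    have := congrArg Fin.val hi
    simp [cc, y₀] at this; omega
  have hx_notmem : ∀ T : Finset (Fin d), x₀ ∉ insert y₀ (T.map cc) := by
    intro T h'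
    rcases Finset.mem_insert.mp h' with h'' | h''
    · have := congrArg Fin.val h''; simp [x₀, y₀] at this
    · obtain ⟨i, -, hi⟩ := Finset.mem_map.mp h''
      have := congrArg Fin.val hi
      simp [cc, x₀] at this; omega
  have hx_notmem' : ∀ T : Finset (Fin d), x₀ ∉ T.map cc := fun T h' =>
    hx_notmem T (Finset.mem_insert_of_mem h')
  -- row equation at a row `S ∈ range u`
  have hroweq : ∀ S : Finset (Fin (d + 2)), S ∈ Set.range u → ∑ k ∈ C0, α k * ∏ a ∈ S, pt k a + ∑ k ∈ C1, α k * ∏ a ∈ S, pt k a = 0 := by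
    rintro S ⟨i₀, hi₀⟩
    have h1 := congrFun hsum i₀
    rw [Finset.sum_apply, Pi.zero_apply] at h1
    simp only [Pi.smul_apply, smul_eq_mul, hi₀] at h1
    have hdisj : Disjoint C0 C1 := by
      rw [Finset.disjoint_left]
      intro k hk0 hk1
      exact hp ((Finset.mem_filter.mp hk0).2.symm.trans (Finset.mem_filter.mp hk1).2)
    rw [← Finset.sum_union hdisj]
    rw [← Finset.sum_subset (Finset.subset_univ (C0 ∪ C1))] at h1
    · exact h1
    · intro k _ hk
      rw [Finset.mem_union, not_or] at hk
      have h0 : (e k).1 ≠ p₀ := fun h' => hk.1 (Finset.mem_filter.mpr ⟨Finset.mem_univ _, h'⟩)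
      have h1' : (e k).1 ≠ p₁ := fun h' => hk.2 (Finset.mem_filter.mpr ⟨Finset.mem_univ _, h'⟩)
      rw [hα k h0 h1', zero_mul]
  -- the structured sums
  let Φ₀ : Finset (Fin d) → ℂ := fun T => ∑ k ∈ C0, α k * (if T ⊆ low k then 1 else 0)
  let Φ₀' : Finset (Fin d) → ℂ := fun T => ∑ k ∈ C0, α k * (if T ⊆ low k ∧ sd ∈ (e k).2 then 1 else 0)
  let Φ₁ : Finset (Fin d) → (ℕ → ℂ) → ℂ := fun T w => ∑ k ∈ C1, α k * ((if T ⊆ low k then 1 else 0) * w (low k).card)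
  -- E00
  have hE00 : ∀ T : Finset (Fin d), Φ₀ T + Φ₁ T (fun _ => 1) = 0 := by
    intro T
    have hS : (T.map cc) ∈ Set.range u := hrows _ (by rw [Finset.card_map]; simpa using Finset.card_le_univ T)
    have := hroweq _ hS
    have h0 : ∀ k ∈ C0, α k * ∏ a ∈ T.map cc, pt k a = α k * (if T ⊆ low k then 1 else 0) := fun k hk => by
      rw [hprodc k (hpt0c k hk) T]
    have h1 : ∀ k ∈ C1, α k * ∏ a ∈ T.map cc, pt k a = α k * ((if T ⊆ low k then 1 else 0) * (fun _ : ℕ => (1 : ℂ)) (low k).card) :=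
      fun k hk => by rw [hprodc k (hpt1c k hk) T]; beta_reduce; ring
    rw [Finset.sum_congr rfl h0, Finset.sum_congr rfl h1] at this
    exact this
  -- E10 (rows `T ∪ y₀`)
  have hE10 : ∀ T : Finset (Fin d), insert y₀ (T.map cc) ∈ Set.range u → Φ₀' T + Φ₁ T (fun n => (n : ℂ)) = 0 := by
    intro T hS
    have := hroweq _ hS
    have h0 : ∀ k ∈ C0, α k * ∏ a ∈ insert y₀ (T.map cc), pt k a = α k * (if T ⊆ low k ∧ sd ∈ (e k).2 then 1 else 0) := by
      intro k hk
      rw [Finset.prod_insert (hy_notmem T), hpt0y k hk, hprodc k (hpt0c k hk) T]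
      by_cases h1 : T ⊆ low k <;> by_cases h2 : sd ∈ (e k).2 <;> simp [h1, h2]
    have h1 : ∀ k ∈ C1, α k * ∏ a ∈ insert y₀ (T.map cc), pt k a
        = α k * ((if T ⊆ low k then 1 else 0) * (fun n : ℕ => (n : ℂ)) (low k).card) := by
      intro k hk
      rw [Finset.prod_insert (hy_notmem T), hpt1y k hk, hprodc k (hpt1c k hk) T, hcard1 k hk]; beta_reduce; ring
    rw [Finset.sum_congr rfl h0, Finset.sum_congr rfl h1] at this
    exact this
  -- E01 (rows `T ∪ x₀`)
  have hE01 : ∀ T : Finset (Fin d), T.card + 1 ≤ d → Φ₀' T + Φ₁ T (fun n => (n : ℂ) + 1) = 0 := by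
    intro T hT
    have hS : insert x₀ (T.map cc) ∈ Set.range u :=
      hrows _ (by rw [Finset.card_insert_of_notMem (hx_notmem' T), Finset.card_map]; exact hT)
    have := hroweq _ hS
    have h0 : ∀ k ∈ C0, α k * ∏ a ∈ insert x₀ (T.map cc), pt k a = α k * (if T ⊆ low k ∧ sd ∈ (e k).2 then 1 else 0) := by
      intro k hk
      rw [Finset.prod_insert (hx_notmem' T), hpt0x k hk, hprodc k (hpt0c k hk) T]
      by_cases h1 : T ⊆ low k <;> by_cases h2 : sd ∈ (e k).2 <;> simp [h1, h2]
    have h1 : ∀ k ∈ C1, α k * ∏ a ∈ insert x₀ (T.map cc), pt k a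
        = α k * ((if T ⊆ low k then 1 else 0) * (fun n : ℕ => (n : ℂ) + 1) (low k).card) := by
      intro k hk
      rw [Finset.prod_insert (hx_notmem' T), hpt1x k hk, hprodc k (hpt1c k hk) T, hcard1 k hk]; beta_reduce; ring
    rw [Finset.sum_congr rfl h0, Finset.sum_congr rfl h1] at this
    exact this
  -- E11 (rows `T ∪ y₀ ∪ x₀`)
  have hE11 : ∀ T : Finset (Fin d), T.card + 2 ≤ d → Φ₀' T + Φ₁ T (fun n => (n : ℂ) * ((n : ℂ) + 1)) = 0 := by
    intro T hT
    have hS : insert x₀ (insert y₀ (T.map cc)) ∈ Set.range u :=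
      hrows _ (by rw [Finset.card_insert_of_notMem (hx_notmem T), Finset.card_insert_of_notMem (hy_notmem T),
        Finset.card_map]; omega)
    have := hroweq _ hS
    have h0 : ∀ k ∈ C0, α k * ∏ a ∈ insert x₀ (insert y₀ (T.map cc)), pt k a
        = α k * (if T ⊆ low k ∧ sd ∈ (e k).2 then 1 else 0) := by
      intro k hk
      rw [Finset.prod_insert (hx_notmem T), Finset.prod_insert (hy_notmem T), hpt0x k hk, hpt0y k hk,
        hprodc k (hpt0c k hk) T]
      by_cases h1 : T ⊆ low k <;> by_cases h2 : sd ∈ (e k).2 <;> simp [h1, h2]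
    have h1 : ∀ k ∈ C1, α k * ∏ a ∈ insert x₀ (insert y₀ (T.map cc)), pt k a
        = α k * ((if T ⊆ low k then 1 else 0) * (fun n : ℕ => (n : ℂ) * ((n : ℂ) + 1)) (low k).card) := by
      intro k hk
      rw [Finset.prod_insert (hx_notmem T), Finset.prod_insert (hy_notmem T), hpt1x k hk, hpt1y k hk,
        hprodc k (hpt1c k hk) T, hcard1 k hk]
      beta_reduce
      ring
    rw [Finset.sum_congr rfl h0, Finset.sum_congr rfl h1] at this
    exact this
  -- fibrewise: Φ₁ T w = Σ_{B ⊇ T} a₁ B * w |B|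
  let a₁ : Finset (Fin d) → ℂ := fun B => ∑ k ∈ C1.filter (fun k => low k = B), α k
  have hΦ₁fib : ∀ T w, Φ₁ T w = ∑ B ∈ Finset.univ.filter (fun B => T ⊆ B), a₁ B * w B.card := by
    intro T w
    simp only [Φ₁]
    rw [sum_mul_apply_eq_sum_fiber C1 low α (fun B => (if T ⊆ B then 1 else 0) * w B.card), Finset.sum_filter]
    refine Finset.sum_congr rfl fun B _ => ?_
    by_cases hTB : T ⊆ B <;> simp [hTB, a₁]
  -- G: Σ_{B ⊇ T} a₁ B = 0 for T ≠ univ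
  have hG : ∀ T : Finset (Fin d), T ≠ Finset.univ → ∑ B ∈ Finset.univ.filter (fun B => T ⊆ B), a₁ B = 0 := by
    intro T hT
    have hTc : T.card + 1 ≤ d := by
      have h1 : T.card < (Finset.univ : Finset (Fin d)).card :=
        Finset.card_lt_card (lt_of_le_of_ne (Finset.subset_univ T) hT)
      rw [Finset.card_univ, Fintype.card_fin] at h1; omega
    have e10 := hE10 T (hrows _ (by rw [Finset.card_insert_of_notMem (hy_notmem T), Finset.card_map]; exact hTc))
    have e01 := hE01 T hTc
    have f10 := hΦ₁fib T (fun n => (n : ℂ))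
    have f01 := hΦ₁fib T (fun n => (n : ℂ) + 1)
    beta_reduce at f10 f01
    have hre : ∑ B ∈ Finset.univ.filter (fun B => T ⊆ B), a₁ B
        = ∑ B ∈ Finset.univ.filter (fun B => T ⊆ B), a₁ B * ((B.card : ℂ) + 1)
          - ∑ B ∈ Finset.univ.filter (fun B => T ⊆ B), a₁ B * (B.card : ℂ) := by
      rw [← Finset.sum_sub_distrib]
      exact Finset.sum_congr rfl fun B _ => by ring
    rw [hre]
    linear_combination e01 - e10 - f01 + f10
  -- parity
  have hpar : ∀ B, a₁ B = (-1 : ℂ) ^ (d - B.card) * a₁ Finset.univ := eq_parity_of_sum_supersets a₁ hG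
  -- H at the co-doubleton {0,1}ᶜ: 2 a₁(univ) = 0
  have hlam : a₁ Finset.univ = 0 := by
    let a : Fin d := ⟨0, by omega⟩
    let b : Fin d := ⟨1, by omega⟩
    have hab : a ≠ b := fun h' => by have := congrArg Fin.val h'; simp [a, b] at this
    set T₀ : Finset (Fin d) := Finset.univ \ {a, b} with hT₀
    have hT₀c : T₀.card + 2 ≤ d := by
      rw [hT₀, Finset.card_sdiff_of_subset (Finset.subset_univ _), Finset.card_univ, Fintype.card_fin, Finset.card_pair hab]
      omega
    have e11 := hE11 T₀ hT₀c
    have e10 := hE10 T₀ (hrows _ (by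
      rw [Finset.card_insert_of_notMem (hy_notmem T₀), Finset.card_map]; omega))
    have f11 := hΦ₁fib T₀ (fun n => (n : ℂ) * ((n : ℂ) + 1))
    have f10 := hΦ₁fib T₀ (fun n => (n : ℂ))
    beta_reduce at f11 f10
    have hdiff : ∑ B ∈ Finset.univ.filter (fun B => T₀ ⊆ B), a₁ B * ((B.card : ℂ) * ((B.card : ℂ) + 1) - (B.card : ℂ)) = 0 := by
      have hre : ∑ B ∈ Finset.univ.filter (fun B => T₀ ⊆ B), a₁ B * ((B.card : ℂ) * ((B.card : ℂ) + 1) - (B.card : ℂ))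
          = ∑ B ∈ Finset.univ.filter (fun B => T₀ ⊆ B), a₁ B * ((B.card : ℂ) * ((B.card : ℂ) + 1))
            - ∑ B ∈ Finset.univ.filter (fun B => T₀ ⊆ B), a₁ B * (B.card : ℂ) := by
        rw [← Finset.sum_sub_distrib]
        exact Finset.sum_congr rfl fun B _ => by ring
      rw [hre]
      linear_combination e11 - e10 - f11 + f10
    have hw : ∀ B ∈ Finset.univ.filter (fun B => T₀ ⊆ B),
        a₁ B * ((B.card : ℂ) * ((B.card : ℂ) + 1) - (B.card : ℂ)) = a₁ Finset.univ * ((-1 : ℂ) ^ (d - B.card) * ((B.card : ℂ) ^ 2)) := by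
      intro B _
      rw [hpar B]; ring
    rw [Finset.sum_congr rfl hw, ← Finset.mul_sum, hT₀, parity_quadratic_moment a b hab] at hdiff
    exact (mul_eq_zero.mp hdiff).resolve_right two_ne_zero
  have ha₁ : ∀ B, a₁ B = 0 := fun B => by rw [hpar B, hlam, mul_zero]
  have hΦ₁zero : ∀ T w, Φ₁ T w = 0 := by
    intro T w
    rw [hΦ₁fib T w]
    exact Finset.sum_eq_zero fun B _ => by rw [ha₁ B, zero_mul]
  -- the p₀-part: Φ₀ T = 0 and Φ₀' T = 0 for all T
  have hΦ₀ : ∀ T, Φ₀ T = 0 := fun T => by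
    have h1 := hE00 T
    have h2 := hΦ₁zero T (fun _ => 1)
    linear_combination h1 - h2
  have hΦ₀' : ∀ T, Φ₀' T = 0 := by
    intro T
    have hS : insert y₀ (T.map cc) ∈ Set.range u := by
      by_cases hT : T = Finset.univ
      · -- the special row `univ ∖ x₀`
        have : insert y₀ (T.map cc) = Finset.univ.erase (Fin.last (d + 1)) := by
          ext a'
          simp only [Finset.mem_insert, Finset.mem_map, hT, Finset.mem_univ, true_and, Finset.mem_erase, and_true]
          constructor
          · rintro (rfl | ⟨i, rfl⟩)
            · intro h'; have := congrArg Fin.val h'; simp [y₀] at this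
            · intro h'; have := congrArg Fin.val h'; simp [cc] at this; omega
          · intro hne
            have hlt : (a' : ℕ) < d + 1 := by
              have h1 : (a' : ℕ) ≠ d + 1 := fun h' => hne (Fin.ext (by simp [h']))
              have h2 := a'.2; omega
            by_cases hd' : (a' : ℕ) = d
            · left; exact Fin.ext hd'
            · right; exact ⟨⟨a', by omega⟩, Fin.ext rfl⟩
        rw [this]; exact hrow'
      · have h1 : T.card < (Finset.univ : Finset (Fin d)).card :=
          Finset.card_lt_card (lt_of_le_of_ne (Finset.subset_univ T) hT)
        rw [Finset.card_univ, Fintype.card_fin] at h1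
        exact hrows _ (by rw [Finset.card_insert_of_notMem (hy_notmem T), Finset.card_map]; omega)
    have h1 := hE10 T hS
    have h2 := hΦ₁zero T (fun n => (n : ℂ))
    linear_combination h1 - h2
  -- fibrewise for p₀: keys `low k`, split by `sd ∈ (e k).2`
  let a₀ : Finset (Fin d) → ℂ := fun A => ∑ k ∈ C0.filter (fun k => low k = A), α k
  let a₀' : Finset (Fin d) → ℂ := fun A => ∑ k ∈ C0.filter (fun k => low k = A), (if sd ∈ (e k).2 then α k else 0)
  let a₀'' : Finset (Fin d) → ℂ := fun A => ∑ k ∈ C0.filter (fun k => low k = A), (if sd ∈ (e k).2 then 0 else α k)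
  have ha₀ : ∀ A, a₀ A = 0 := by
    refine eq_zero_of_sum_supersets a₀ fun T => ?_
    have := hΦ₀ T
    simp only [Φ₀] at this
    rw [sum_mul_apply_eq_sum_fiber C0 low α (fun A => if T ⊆ A then 1 else 0)] at this
    refine Eq.trans ?_ this
    rw [Finset.sum_filter]
    refine Finset.sum_congr rfl fun A _ => ?_
    by_cases hTA : T ⊆ A <;> simp [hTA, a₀]
  have ha₀' : ∀ A, a₀' A = 0 := by
    refine eq_zero_of_sum_supersets a₀' fun T => ?_
    have := hΦ₀' T
    simp only [Φ₀'] at this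
    have hsplit : ∑ k ∈ C0, α k * (if T ⊆ low k ∧ sd ∈ (e k).2 then (1 : ℂ) else 0)
        = ∑ k ∈ C0, (if sd ∈ (e k).2 then α k else 0) * (if T ⊆ low k then 1 else 0) := by
      refine Finset.sum_congr rfl fun k _ => ?_
      by_cases h1 : T ⊆ low k <;> by_cases h2 : sd ∈ (e k).2 <;> simp [h1, h2]
    rw [hsplit, sum_mul_apply_eq_sum_fiber C0 low (fun k => if sd ∈ (e k).2 then α k else 0) (fun A => if T ⊆ A then 1 else 0)] at this
    refine Eq.trans ?_ this
    rw [Finset.sum_filter]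
    refine Finset.sum_congr rfl fun A _ => ?_
    by_cases hTA : T ⊆ A <;> simp [hTA, a₀']
  have ha₀'' : ∀ A, a₀'' A = 0 := by
    intro A
    have hsum3 : a₀ A = a₀' A + a₀'' A := by
      simp only [a₀, a₀', a₀'', ← Finset.sum_add_distrib]
      refine Finset.sum_congr rfl fun k _ => ?_
      by_cases h2 : sd ∈ (e k).2 <;> simp [h2]
    have := ha₀ A
    rw [hsum3, ha₀' A, zero_add] at this
    exact this
  -- conclusion: every coefficient is a singleton fibre sum (`stateSet_ext`: a column is determined by `low` and the `d`-bit)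
  have hlow_iff : ∀ k k', low k' = low k → ∀ i : Fin d, st i ∈ (e k').2 ↔ st i ∈ (e k).2 := by
    intro k k' hlow i
    have h1 : i ∈ low k' ↔ i ∈ low k := by rw [hlow]
    simpa [low] using h1
  have hkey0 : ∀ k ∈ C0, ∀ k' ∈ C0, low k' = low k → (sd ∈ (e k').2 ↔ sd ∈ (e k).2) → k' = k := by
    intro k hk k' hk' hlow hsd
    apply he
    refine Prod.ext ((Finset.mem_filter.mp hk').2.trans (Finset.mem_filter.mp hk).2.symm) ?_
    exact stateSet_ext hK _ _ (hP0 k' (Finset.mem_filter.mp hk').2) (hP0 k (Finset.mem_filter.mp hk).2) (hlow_iff k k' hlow) hsd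
  have hkey1 : ∀ k ∈ C1, ∀ k' ∈ C1, low k' = low k → k' = k := by
    intro k hk k' hk' hlow
    apply he
    refine Prod.ext ((Finset.mem_filter.mp hk').2.trans (Finset.mem_filter.mp hk).2.symm) ?_
    have h1 := hP1 k' (Finset.mem_filter.mp hk').2
    have h2 := hP1 k (Finset.mem_filter.mp hk).2
    refine stateSet_ext hK _ _ (fun q hq => by have := h1 q hq; omega) (fun q hq => by have := h2 q hq; omega)
      (hlow_iff k k' hlow) ?_
    constructor
    · intro h; have := h1 _ h; simp at this
    · intro h; have := h2 _ h; simp at this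
  intro k
  by_cases hk0 : (e k).1 = p₀
  · have hkC : k ∈ C0 := Finset.mem_filter.mpr ⟨Finset.mem_univ _, hk0⟩
    by_cases hsd : sd ∈ (e k).2
    · have := ha₀' (low k)
      simp only [a₀'] at this
      have hmem : k ∈ C0.filter (fun k' => low k' = low k) := Finset.mem_filter.mpr ⟨hkC, rfl⟩
      rw [Finset.sum_eq_single_of_mem k hmem] at this
      · rwa [if_pos hsd] at this
      · intro k' hk' hne
        obtain ⟨hk'C, hlow⟩ := Finset.mem_filter.mp hk'
        by_cases hsd' : sd ∈ (e k').2
        · exact absurd (hkey0 k hkC k' hk'C hlow (by simp [hsd, hsd'])) hne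
        · rw [if_neg hsd']
    · have := ha₀'' (low k)
      simp only [a₀''] at this
      have hmem : k ∈ C0.filter (fun k' => low k' = low k) := Finset.mem_filter.mpr ⟨hkC, rfl⟩
      rw [Finset.sum_eq_single_of_mem k hmem] at this
      · rwa [if_neg hsd] at this
      · intro k' hk' hne
        obtain ⟨hk'C, hlow⟩ := Finset.mem_filter.mp hk'
        by_cases hsd' : sd ∈ (e k').2
        · rw [if_pos hsd']
        · exact absurd (hkey0 k hkC k' hk'C hlow (by simp [hsd, hsd'])) hne
  · by_cases hk1 : (e k).1 = p₁
    · have hkC : k ∈ C1 := Finset.mem_filter.mpr ⟨Finset.mem_univ _, hk1⟩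
      have := ha₁ (low k)
      simp only [a₁] at this
      have hmem : k ∈ C1.filter (fun k' => low k' = low k) := Finset.mem_filter.mpr ⟨hkC, rfl⟩
      rw [Finset.sum_eq_single_of_mem k hmem] at this
      · exact this
      · intro k' hk' hne
        obtain ⟨hk'C, hlow⟩ := Finset.mem_filter.mp hk'
        exact absurd (hkey1 k hkC k' hk'C hlow) hne
    · exact hα k hk0 hk1

end Tilt

end

end Summit.ValiantsHypothesis.ValiantsHypothesis.Theorems.BarrierLever.HiddenStates
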